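import Literature.MathematicalPhysics.QuantumFieldTheory.Balaban1983to89.B2Eq244Cutoff
import Literature.MathematicalPhysics.QuantumFieldTheory.Balaban1983to89.B2Prop31MinimizerFamilyK

/-!
# `Balaban1983to89.B2Prop31MinimizerWitness` — [Balaban1982Higgs2] Proposition 3.1 p. 589: NON-VACUITY of the corrected family
`B2Prop31MinimizerFamilyK.RMultiMK` (printed (3.3) minimizers over printed (2.55) restrictions) AT `K = 1` WITH A NON-ZERO FIELD `Ã^ε`,
on every torus of the sub-family with a fine enough lattice — the (2.44) cut-off supplied by `B2Eq244Cutoff.zeta244`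

statement-level skeleton of published theorems with citation tags; proofs where landed; nothing here is a claim about the Yang–Mills mass gap

CITATION HEADER.  T. Bałaban, *(Higgs)₂,₃ quantum fields in a finite volume. II. An upper bound*, Commun. Math. Phys. **86**
(1982) 555–594 [Balaban1982Higgs2] (PDF held `paper:balaban1982-cmp86-higgs23-ii`, journal page = PDF page + 554; pp. 558, 566, 570–571,
583, 588–589).  Cell `lit-balaban` (HOME `run/shared/lean/pub/lit-balaban/`), Phase-2 proof seat **p23** gen 12 (unit `lit-balaban-p23-g12`;
TAKING line HOME/STATUS.md 2026-08-22T02:39:47Z; owner r02's note `lit-balaban-p23/INBOX.md` 02:21:38Z: *"a (2.44) ζ^{(k)}-witness …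
giving an instance with K ≥ 1 and `restrictedM` satisfied non-trivially (pattern of your gen-10 `exists_restricted_ne_zero`)"*).  SKELETON
rows **B2.Prop3.1** (decl of record `B2.Prop31Printed`, owner r02), **B2.Eq3.29**, **B2.Eq2.44**; second reader r14, referee ref-4.  USED BY
NAME, NOTHING RESTATED: `B2Prop31MinimizerFamilyK.{RMultiMK, RMultiMK.restrictedM, RMultiMK.field, RMultiMK.A}` (p23 g12),
`B2Eq244Cutoff.{zeta244, zeta244_cutoff244, abs_zeta244_le_one, zeta244_supp, zeta244_lip, le_rFn}` (p23 g12), `B2Prop31MinimizerFamily.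
{MinConsts, Lemma23Bounds, exists_lemma23Bounds, exp_neg_delta_rho_le}` (p23 g11), `B2Prop31PrintedRestrictions.witnessTower` (p23 g10: the
one-step tower `Λ₅⁽⁰⁾ = T_ε`, `Λ₅⁽¹⁾ = ∅`), `B2Eq32FieldRegularity.field32_eq_top` (p23 g10), r14's `B2Lemma23HiggsLattice.cutMin` (p312208),
the typer's `B3MultiscaleFields.{toSite, ofSite, zeroCharge}`, `HiggsLattice`, `B1Eq211ZeroFieldTorus.Shape`, b2b's `B2.{Params, rFn}`,
`B1.{aSeq, ainf_lt_aSeq}`.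

THE WITNESS (§1).  On a torus `P` of the sub-family (`P.L = Q.L`, `P.d = Q.d`, `P.K ≥ 1`, `Lε ≤ ε₀`): ONE step (`K = 1`); `Λ₅⁽⁰⁾ = T_ε`
(so `Λ₁ = T⁽¹⁾`: the small-field region is the whole torus and every restriction clause is live); `θ₁ ≡ 1`, `θ_m ≡ 0` otherwise;
`A₀ = 0`; the block field `A_1 ≡ v` (a constant vector `v ∈ ℝᵈ` on every coarse bond direction); `Φ = 0`; the regions `Λ₁ = Λ₂ = T⁽ᵏ⁾`;
and the (2.44) cut-offs `ζ^{(k)} := zeta244 k (r(Lᵏε))` of `B2Eq244Cutoff` (their four clauses at the step `k = 1 ≤ P.K` from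
`zeta244_cutoff244`, `R ≥ 6`).  Its (3.3) minimizer is `A^{(1),ε}(x) = a₁(Lε)^{−2}(ζ^{(1)}G^ε_1Q*_1v)(x)` and its field is `Ã^ε = A^{(1),ε}`
(`θ₁ ≡ 1`).  `restrictedM` holds iff `‖v‖ ≤ c_{A1}(Lε)^{−d/2}p(Lε)` ((2.55)₂; the variation (2.55)₁ of a constant is `0`, the slice and
`φ` clauses are vacuous/zero).  NON-ZERO FIELD (§2): Lemma 2.3 on the carrier (r14's `lemma23_higgsLattice`, packaged as gen 11's
`Lemma23Bounds`) with variation modulus `q = 0` gives `‖A^{(1),ε}(x) − v‖ ≤ (C₂e^{−δr(Lε)/2} + μ₀²(Lε)²/(a₁ + μ₀²(Lε)²))‖v‖ ≤ (C₂ + μ₀²/a_∞)·Lε·‖v‖`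
(`e^{−δr/2} ≤ Lε` for `R ≥ 2/δ`, gen 11's `exp_neg_delta_rho_le`; `a₁ > a_∞ = a(1 − L⁻²)`), `< ‖v‖` once `Lε < 1/(C₂ + μ₀²/a_∞)` — so
`A^{(1),ε}(x) ≠ 0` at every `x` when `v ≠ 0`.

WHAT THIS MODULE PROVES (kernel-checked, 0 `sorry`, standard axioms; definitions with bodies `thetaW`, `chargeW`, `witness`, `kappaW`,
`witnessTorus`, `witnessShape`; no `Prop` facts).
 §1 `thetaW` (+ `nested_thetaW`, `thetaW_one`, `thetaW_of_ne`), `chargeW`, **`witness`** (an `RMultiMK Q Γ m²`), `witness_K`, `witness_lam_zero`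
    (`Λ₅⁽⁰⁾ = T_ε`), `witness_field_apply` (`Ã^ε(⟨x, μ⟩) = A^{(1),ε}(x)_μ`), **`witness_restrictedM`** (`‖v‖ ≤ thrA(Lε) ⇒ restrictedM`);
 §2 `norm_cutMin_const_sub_le` (the Lemma-2.3 bound for a constant block field), `kappaW`, `norm_cutMin_const_sub_lt` (`< ‖v‖` for
    `κ·Lε < 1`, `v ≠ 0`), **`witness_field_ne_zero`**;
 §3 **`exists_restrictedM_field_ne_zero`**: for `d ≥ 1`, odd `L > 1`, `a > 0`, valid `Γ` there are `R₁ > 0`, `0 < s₁ ≤ ε₀` such that for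
    every `Q` (`Q.d = d`, `Q.L = L`, `Q.a = a`, `Q.R ≥ R₁`, `Q.r ≥ 1`), every `m²`, EVERY torus `P` of the sub-family with `P.d = d`, `P.L = L`,
    `P.K ≥ 1`, `Lε ≤ s₁`, and every `v ≠ 0` with `‖v‖ ≤ thrA(Lε)`, there is `i : RMultiMK Q Γ m²` on `P` with `i.K = 1`, `Λ₅⁽⁰⁾ = T_ε`,
    `i.restrictedM` and `i.field ≠ 0`; `thrA_pos` (`c_{A1} > 0`, `b₀ > 0 ⇒ thrA(s) > 0` for `0 < s ≤ 1`, so such `v` exist), `witnessTorus` /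
    `witnessShape` (a torus of the sub-family with `K = 1`, `Lε = s`), and the hypothesis-free corollary **`exists_restrictedM_field_ne_zero'`**.
HONEST SCOPE.  (i) One renormalization step only (`K = 1`); multi-step witnesses would need towers with non-trivial `θ_k`-slices
(the printed `θ_k` of p. 567) — not attempted.  (ii) The block field is a constant; its admissibility is exactly (2.55)₂.  (iii) The
smallness `Lε ≤ s₁` and `R ≥ R₁ = max(6, 2/δ)` depend on r14's Lemma-2.3 constants `(δ, C₂)` (existential, from p14's decay bounds).
(iv) Zero external field / torus sub-family / `N = 1` scalar component with `q = 0` as in gen 10's witness.  (v) No row head changes are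
claimed (owner r02).  Nothing here is summit progress.
-/

noncomputable section

open Finset Real
open scoped BigOperators

namespace Literature.MathematicalPhysics.QuantumFieldTheory.Balaban1983to89.B2Prop31MinimizerWitness

open Literature.MathematicalPhysics.QuantumFieldTheory.Balaban1983to89.HiggsLattice
open Literature.MathematicalPhysics.QuantumFieldTheory.Balaban1983to89.HiggsAveraging
open Literature.MathematicalPhysics.QuantumFieldTheory.Balaban1983to89.B2Eq337ScalarIntegration
open Literature.MathematicalPhysics.QuantumFieldTheory.Balaban1983to89.B2Eq328ConcretePieces
open Literature.MathematicalPhysics.QuantumFieldTheory.Balaban1983to89.B2Prop31ZeroFieldConcrete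
open Literature.MathematicalPhysics.QuantumFieldTheory.Balaban1983to89.B2Eq324NestedRegions
open Literature.MathematicalPhysics.QuantumFieldTheory.Balaban1983to89.B2Eq32FieldRegularity
open Literature.MathematicalPhysics.QuantumFieldTheory.Balaban1983to89.B2Prop31Thresholds
open Literature.MathematicalPhysics.QuantumFieldTheory.Balaban1983to89.B2Prop31PrintedRestrictions
open Literature.MathematicalPhysics.QuantumFieldTheory.Balaban1983to89.B3MultiscaleFields (toSite ofSite zeroCharge toSite_ofSite)
open Literature.MathematicalPhysics.QuantumFieldTheory.Balaban1983to89.B2Lemma23HiggsLattice (cutMin)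
open Literature.MathematicalPhysics.QuantumFieldTheory.Balaban1983to89.B1Eq211ZeroFieldTorus (Shape)
open Literature.MathematicalPhysics.QuantumFieldTheory.Balaban1983to89.B2Prop31MinimizerFamily
  (MinConsts Lemma23Bounds exists_lemma23Bounds exp_neg_delta_rho_le)
open Literature.MathematicalPhysics.QuantumFieldTheory.Balaban1983to89.B2Prop31MinimizerFamilyK (RMultiMK)
open Literature.MathematicalPhysics.QuantumFieldTheory.Balaban1983to89.B2Eq244Cutoff
  (zeta244 zeta244_cutoff244 abs_zeta244_le_one zeta244_supp zeta244_lip le_rFn)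
open B2Sect2BDensities (Nested)

/-! ## §1 The one-step witness -/

section Witness

variable {P : HiggsLattice.Params}

/-- The cut-offs of the witness: `θ₁ ≡ 1`, `θ_m ≡ 0` for `m ≠ 1` (one step; the small-field region is the whole torus).
[cite: Balaban1982Higgs2, (3.2) p.583, p.567] -/
def thetaW (P : HiggsLattice.Params) : ℕ → HiggsLattice.Site P 0 → ℝ := fun k _ => if k = 1 then 1 else 0

/-- `θ₁ = 1`. [cite: Balaban1982Higgs2, p.567] -/
theorem thetaW_one (z : HiggsLattice.Site P 0) : thetaW P 1 z = 1 := if_pos rfl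

/-- `θ_m = 0` for `m ≠ 1`. [cite: Balaban1982Higgs2, p.567] -/
theorem thetaW_of_ne {m : ℕ} (hm : m ≠ 1) (z : HiggsLattice.Site P 0) : thetaW P m z = 0 := if_neg hm

/-- The witness cut-offs are nested (`θ_{j+1}θ_j = θ_{j+1}`: `θ_{j+1} = 0` for `j ≥ 1`). [cite: Balaban1982Higgs2, (2.51) p.569] -/
theorem nested_thetaW : Nested (thetaW P) := by
  intro j z hj
  have hj1 : j + 1 ≠ 1 := by omega
  rw [thetaW_of_ne hj1, zero_mul]

/-- The charge data of the witness: one real scalar component, `q = 0`, the model's coupling `e`. [cite: Balaban1982Higgs1, (1.7) p.605] -/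
def chargeW (e : ℝ) : ChargeData 1 :=
  ⟨e, 0, by rw [neg_zero]; exact star_zero (EuclideanSpace ℝ (Fin 1) →L[ℝ] EuclideanSpace ℝ (Fin 1)),
    by rw [norm_zero]; exact zero_le_one⟩

/-- `thrQ(s) ≥ 0` for `0 < s ≤ 1`. [cite: Balaban1982Higgs2, (2.55) p.570] -/
theorem thrQ_nonneg {Γ : MinConsts} (hΓ : Γ.Valid) {s : ℝ} (hs : 0 < s) (hs1 : s ≤ 1) (d : ℕ) : 0 ≤ Γ.thrQ d s := by
  unfold MinConsts.thrQ
  have hp : 0 ≤ B2.pFn Γ.b₀ Γ.p s := pFn_nonneg' (Γ := Γ.toConsts 0 0) (MinConsts.toConsts_valid hΓ le_rfl le_rfl) hs hs1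
  have := hΓ.cq_nonneg
  have : 0 ≤ s ^ (-((d : ℝ) - 2) / 2) := Real.rpow_nonneg hs.le _
  positivity

variable {Q : B2.Params} {Γ : MinConsts} {m2 : ℝ}

/-- **THE ONE-STEP WITNESS** of the corrected family on a torus `P` of the sub-family (`P.L = Q.L`, `P.d = Q.d`, `P.K ≥ 1`, `Lε ≤ ε₀`),
for `R ≥ 6`, `r ≥ 0` and valid `Γ`: `K = 1`, `Λ₅⁽⁰⁾ = T_ε` / `Λ₅⁽¹⁾ = ∅` (gen 10's `witnessTower`), `θ₁ ≡ 1`, `A₀ = 0`, block fields `A_k ≡ v`,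
`Φ = 0`, regions `Λ₁ = Λ₂ = T⁽ᵏ⁾`, and the (2.44) cut-offs `ζ^{(k)} := zeta244 k (r(Lᵏε))` (four clauses at `k = 1` by `zeta244_cutoff244`).
[cite: Balaban1982Higgs2, Prop. 3.1 p.589, (3.2)–(3.3) p.583, (2.44) p.566, (3.23) p.588] -/
def witness (hΓ : Γ.Valid) (hR : 6 ≤ Q.R) (hr : 0 ≤ Q.r) (P : HiggsLattice.Params) (S : Shape P) (hPL : P.L = Q.L)
    (hPd : P.d = Q.d) (hK1 : 1 ≤ P.K) (hε₀ : P.mesh 1 ≤ Γ.ε₀) (v : EuclideanSpace ℝ (Fin P.d)) : RMultiMK Q Γ m2 where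
  P := P
  hL := hPL
  hd := hPd
  S := S
  N := 1
  K := 1
  hK := hK1
  hε₀ := hε₀
  T := witnessTower P
  C := chargeW Γ.e
  hCe := rfl
  θ := thetaW P
  θ_nested := nested_thetaW
  θ_range m z := by
    by_cases hm : m = 1
    · subst hm; rw [thetaW_one]; norm_num
    · rw [thetaW_of_ne hm]; norm_num
  θ_one k hk1 hkK z _ := by
    obtain rfl : k = 1 := by omega
    exact ⟨thetaW_one z, fun ν => thetaW_one _⟩
  θ_zero k hk z _ := by omega
  θ_above m hm z := thetaW_of_ne (by omega) z
  θ_lip k z ν := by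
    have h0 : thetaW P (k + 1) (z.shift ν) - thetaW P (k + 1) z = 0 := by
      by_cases hk : k + 1 = 1
      · rw [hk, thetaW_one, thetaW_one, sub_self]
      · rw [thetaW_of_ne hk, thetaW_of_ne hk, sub_self]
    rw [h0, abs_zero]
    exact mul_nonneg hΓ.cθ_nonneg (inv_nonneg.2 (pow_nonneg (Nat.cast_nonneg _) _))
  A₀ := 0
  Ac k := ofSite (fun _ : HiggsLattice.Site P k => v)
  Φ := 0
  ζ k := zeta244 P k (B2.rFn Q.R Q.r (P.mesh k))
  ζ_abs k _ _ x y' := abs_zeta244_le_one _ x y'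
  ζ_supp k _ hk x y' h := zeta244_supp (hk.trans hK1) h
  ζ_one k _ hk x y' h := by
    have hs1 : P.mesh k ≤ 1 := (mesh_le_mesh hk).trans (hε₀.trans hΓ.ε₀_le_one)
    exact (zeta244_cutoff244 (hk.trans hK1) hR hr hs1).2.2.1 x y' h
  ζ_lip k _ _ x ν y' := zeta244_lip _ x ν y'
  L1 _ := Finset.univ
  L2 _ := Finset.univ
  L2_sub _ := Finset.Subset.refl _
  nbhd _ _ y' _ _ := Finset.mem_univ y'
  lam_sub j _ := Finset.subset_univ _
  slice_sub j z ν _ := Finset.mem_univ _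

variable (hΓ : Γ.Valid) (hR : 6 ≤ Q.R) (hr : 0 ≤ Q.r) (P : HiggsLattice.Params) (S : Shape P) (hPL : P.L = Q.L)
  (hPd : P.d = Q.d) (hK1 : 1 ≤ P.K) (hε₀ : P.mesh 1 ≤ Γ.ε₀) (v : EuclideanSpace ℝ (Fin P.d))

/-- One step. [cite: Balaban1982Higgs2, Prop. 3.1 p.589] -/
theorem witness_K : (witness (m2 := m2) hΓ hR hr P S hPL hPd hK1 hε₀ v).K = 1 := rfl

/-- The lattice of the witness is the given torus. [cite: Balaban1982Higgs1, (1.2) p.604] -/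
theorem witness_P : (witness (m2 := m2) hΓ hR hr P S hPL hPd hK1 hε₀ v).P = P := rfl

/-- **The small-field region is the whole torus**: `Λ₅⁽⁰⁾ = T_ε` (so `Λ₁ = T⁽¹⁾` and every restriction clause is live).
[cite: Balaban1982Higgs2, (3.23) p.588] -/
theorem witness_lam_zero : (witness (m2 := m2) hΓ hR hr P S hPL hPd hK1 hε₀ v).T.lam 0 = Finset.univ := by
  show (if (0 : ℕ) = 0 then (Finset.univ : Finset (HiggsLattice.Site P 0)) else ∅) = Finset.univ
  rw [if_pos rfl]

/-- **The field of the witness IS its (3.3) minimizer**: `Ã^ε(⟨x, x + εe_μ⟩) = A^{(1),ε}(x)_μ = (a₁(Lε)^{−2}ζ^{(1)}G^ε_1Q*_1v)(x)_μ`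
(`θ₁ ≡ 1`, gen 10's `field32_eq_top`). [cite: Balaban1982Higgs2, (3.2)–(3.3) p.583] -/
theorem witness_field_apply (b : HiggsLattice.PBond P 0) :
    (witness (m2 := m2) hΓ hR hr P S hPL hPd hK1 hε₀ v).field b
      = cutMin (zeroCharge P.d) Γ.μ0sq Q.a 1 (zeta244 P 1 (B2.rFn Q.R Q.r (P.mesh 1))) (fun _ => v) b.src b.dir := by
  show field32 (thetaW P) 0 (witness (m2 := m2) hΓ hR hr P S hPL hPd hK1 hε₀ v).A 1 b = _
  rw [field32_eq_top (thetaW P) 0 _ nested_thetaW le_rfl b (thetaW_one _)]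
  show ofSite (cutMin (zeroCharge P.d) Γ.μ0sq Q.a 1 (zeta244 P 1 (B2.rFn Q.R Q.r (P.mesh 1)))
    (toSite (ofSite fun _ : HiggsLattice.Site P 1 => v))) b = _
  rw [toSite_ofSite]
  rfl

/-- **THE WITNESS IS RESTRICTED** as soon as the constant block field obeys (2.55)₂, `‖v‖ ≤ c_{A1}(Lε)^{−d/2}p(Lε)`: the variation
clause (2.55)₁ of a constant is `0 ≤ thrQ·(r₁ + r₂|y − y′|)`, the (2.17) slice clause is vacuous (`θ₂ ≡ 0`), and `Φ = 0` meets (2.55)₄.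
[cite: Balaban1982Higgs2, Prop. 3.1 p.589, (2.55) p.570, (2.17) p.560, (3.15) p.586] -/
theorem witness_restrictedM (hv : ‖v‖ ≤ Γ.thrA P.d (P.mesh 1)) :
    (witness (m2 := m2) hΓ hR hr P S hPL hPd hK1 hε₀ v).restrictedM := by
  have hs1 : P.mesh 1 ≤ 1 := hε₀.trans hΓ.ε₀_le_one
  refine ⟨?_, ?_, ?_, ?_⟩
  · intro k hk1 hk y' _
    change k ≤ 1 at hk
    obtain rfl : k = 1 := le_antisymm hk hk1
    show ‖toSite (ofSite fun _ : HiggsLattice.Site P 1 => v) y'‖ ≤ Γ.thrA P.d (P.mesh 1)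
    rw [toSite_ofSite]
    exact hv
  · intro k hk1 hk y _ y' _
    change k ≤ 1 at hk
    obtain rfl : k = 1 := le_antisymm hk hk1
    show ‖toSite (ofSite fun _ : HiggsLattice.Site P 1 => v) y' - toSite (ofSite fun _ : HiggsLattice.Site P 1 => v) y‖
      ≤ Γ.thrQ P.d (P.mesh 1) * (Γ.r₁ + Γ.r₂ * (HiggsLattice.Site.tdist y y' : ℝ))
    rw [toSite_ofSite, sub_self, norm_zero]
    have h1 := thrQ_nonneg hΓ (P.mesh_pos 1) hs1 P.d
    have h2 := hΓ.r₁_nonneg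
    have h3 := hΓ.r₂_nonneg
    positivity
  · intro j z _ μ ν hsl
    exfalso
    have hj : j.val + 2 ≠ 1 := by omega
    rcases hsl with h | h
    · exact h (thetaW_of_ne hj z)
    · exact h (thetaW_of_ne (P := P) hj (z.shift ν))
  · intro j y
    show ‖(0 : V 1)‖ ≤ _
    rw [norm_zero]
    have hj : j.val = 0 := by
      have h := j.isLt
      change j.val < 1 at h
      omega
    have hsj : 0 < P.mesh (j.val + 1) ∧ P.mesh (j.val + 1) ≤ 1 := by rw [hj]; exact ⟨P.mesh_pos 1, hs1⟩
    unfold MinConsts.thrφM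
    have hp : 0 ≤ B2.pFn Γ.b₀ Γ.p (P.mesh (j.val + 1)) :=
      pFn_nonneg' (Γ := Γ.toConsts 0 0) (MinConsts.toConsts_valid hΓ le_rfl le_rfl) hsj.1 hsj.2
    have := hΓ.cφ_nonneg
    have := hΓ.lam_pos
    have : 0 ≤ Γ.lam ^ (-(1 / 4 : ℝ)) := Real.rpow_nonneg hΓ.lam_pos.le _
    have : 0 ≤ P.mesh (j.val + 1) ^ (-(P.d : ℝ) / 4) := Real.rpow_nonneg hsj.1.le _
    positivity

end Witness

/-! ## §2 The field of the witness is not zero: Lemma 2.3 for a constant block field -/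

section NonZero

/-- **LEMMA 2.3 (2.59) FOR A CONSTANT BLOCK FIELD** (variation modulus `q = 0`, regions = the whole torus): on a torus of the sub-family
with `P.d = d`, `P.L = L`, `P.K ≥ 1`, `Lε ≤ min(ε₀, 1)`, given Lemma-2.3 constants `(δ, C₁, C₂)` (gen 11's `Lemma23Bounds`), `R ≥ max(6, 2/δ)`,
`r ≥ 1`: `‖A^{(1),ε}(x) − v‖ ≤ (C₂·Lε + μ₀²(Lε)²/(a₁ + μ₀²(Lε)²))·‖v‖` at every fine point `x` (`e^{−δr(Lε)/2} ≤ Lε`, gen 11's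
`exp_neg_delta_rho_le`). [cite: Balaban1982Higgs2, Lemma 2.3 (2.59) p.571, (2.62)–(2.63) p.571, (2.44) p.566, (2.7) p.558] -/
theorem norm_cutMin_const_sub_le {d L : ℕ} {a μ0sq ε₀ δ C₁ C₂ : ℝ}
    (pkg : Lemma23Bounds d L a μ0sq ε₀ δ C₁ C₂) (hδ : 0 < δ) (hC₂ : 0 ≤ C₂)
    {P : HiggsLattice.Params} (S : Shape P) (hPd : P.d = d) (hPL : P.L = L) (hK1 : 1 ≤ P.K)
    (hsε : P.mesh 1 ≤ ε₀) (hs1 : P.mesh 1 ≤ 1) {R r : ℝ} (hR6 : 6 ≤ R) (hRδ : 2 / δ ≤ R) (hr : 1 ≤ r)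
    (v : EuclideanSpace ℝ (Fin P.d)) (x : HiggsLattice.Site P 0) :
    ‖cutMin (zeroCharge P.d) μ0sq a 1 (zeta244 P 1 (B2.rFn R r (P.mesh 1))) (fun _ => v) x - v‖
      ≤ (C₂ * P.mesh 1 + μ0sq * P.mesh 1 ^ 2 / (B1.aSeq a P.L 1 + μ0sq * P.mesh 1 ^ 2)) * ‖v‖ := by
  subst hPd hPL
  obtain ⟨habs, hsupp, hone, hlip⟩ := zeta244_cutoff244 (P := P) hK1 hR6 (by linarith) hs1
  have hρ₁ : 0 ≤ B2.rFn R r (P.mesh 1) / 2 := by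
    have h := le_rFn (by linarith : (0 : ℝ) ≤ R) (by linarith : (0 : ℝ) ≤ r) (P.mesh_pos 1) hs1
    linarith
  obtain ⟨h59, -⟩ := pkg P S rfl rfl (zeroCharge P.d) le_rfl hK1 hsε _ _ _ hρ₁ habs hsupp hone hlip
    Finset.univ Finset.univ (Finset.Subset.refl _) (fun _ y' _ _ => Finset.mem_univ y') (fun _ => v) ‖v‖ 0 0 0
    le_rfl le_rfl le_rfl (fun y' _ => le_rfl) (fun y _ y' _ => by simp) x (Finset.mem_univ _)
  have hE : Real.exp (-(δ * (B2.rFn R r (P.mesh 1) / 2))) ≤ P.mesh 1 := exp_neg_delta_rho_le (P.mesh_pos 1) hs1 hδ hRδ hr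
  have hv : 0 ≤ ‖v‖ := norm_nonneg v
  calc ‖cutMin (zeroCharge P.d) μ0sq a 1 (zeta244 P 1 (B2.rFn R r (P.mesh 1))) (fun _ => v) x - v‖
      ≤ C₁ * (0 + 0) * 0 + C₂ * Real.exp (-(δ * (B2.rFn R r (P.mesh 1) / 2))) * ‖v‖
          + μ0sq * P.mesh 1 ^ 2 / (B1.aSeq a P.L 1 + μ0sq * P.mesh 1 ^ 2) * ‖v‖ := h59
    _ = C₂ * Real.exp (-(δ * (B2.rFn R r (P.mesh 1) / 2))) * ‖v‖
          + μ0sq * P.mesh 1 ^ 2 / (B1.aSeq a P.L 1 + μ0sq * P.mesh 1 ^ 2) * ‖v‖ := by ring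
    _ ≤ C₂ * P.mesh 1 * ‖v‖ + μ0sq * P.mesh 1 ^ 2 / (B1.aSeq a P.L 1 + μ0sq * P.mesh 1 ^ 2) * ‖v‖ := by gcongr
    _ = (C₂ * P.mesh 1 + μ0sq * P.mesh 1 ^ 2 / (B1.aSeq a P.L 1 + μ0sq * P.mesh 1 ^ 2)) * ‖v‖ := by ring

/-- The rate of the bound in units of `Lε`: `κ = C₂ + μ₀²/a_∞`, `a_∞ = a(1 − L⁻²)` ((I.2.15)). [cite: Balaban1982Higgs2, (2.59) p.571]
[cite: Balaban1982Higgs1, (2.15) p.609] -/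
def kappaW (a : ℝ) (L : ℕ) (μ0sq C₂ : ℝ) : ℝ := C₂ + μ0sq / (a * (1 - ((L : ℝ) ^ 2)⁻¹))

/-- `κ ≥ 0` (`a > 0`, `L > 1`, `μ₀² ≥ 0`, `C₂ ≥ 0`). [cite: Balaban1982Higgs1, (2.15) p.609] -/
theorem kappaW_nonneg {a : ℝ} (ha : 0 < a) {L : ℕ} (hL : 1 < L) {μ0sq C₂ : ℝ} (hμ : 0 ≤ μ0sq) (hC₂ : 0 ≤ C₂) :
    0 ≤ kappaW a L μ0sq C₂ := by
  unfold kappaW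
  have hLr : (1 : ℝ) < L := by exact_mod_cast hL
  have hainf : 0 < a * (1 - ((L : ℝ) ^ 2)⁻¹) := by
    have hL2 : 1 < (L : ℝ) ^ 2 := by nlinarith
    have : ((L : ℝ) ^ 2)⁻¹ < 1 := inv_lt_one_of_one_lt₀ hL2
    exact mul_pos ha (by linarith)
  have : 0 ≤ μ0sq / (a * (1 - ((L : ℝ) ^ 2)⁻¹)) := div_nonneg hμ hainf.le
  linarith

/-- **`‖A^{(1),ε}(x) − v‖ < ‖v‖`, hence `A^{(1),ε}(x) ≠ 0`, for `v ≠ 0` and `κ·Lε < 1`** (`μ₀²(Lε)²/(a₁ + μ₀²(Lε)²) ≤ (μ₀²/a_∞)·Lε`,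
`a₁ > a_∞`, `Lε ≤ 1`). [cite: Balaban1982Higgs2, Lemma 2.3 (2.59) p.571, (3.3) p.583] -/
theorem norm_cutMin_const_sub_lt {d L : ℕ} {a μ0sq ε₀ δ C₁ C₂ : ℝ} (ha : 0 < a) (hμ : 0 < μ0sq)
    (pkg : Lemma23Bounds d L a μ0sq ε₀ δ C₁ C₂) (hδ : 0 < δ) (hC₂ : 0 ≤ C₂)
    {P : HiggsLattice.Params} (S : Shape P) (hPd : P.d = d) (hPL : P.L = L) (hK1 : 1 ≤ P.K)
    (hsε : P.mesh 1 ≤ ε₀) (hs1 : P.mesh 1 ≤ 1) {R r : ℝ} (hR6 : 6 ≤ R) (hRδ : 2 / δ ≤ R) (hr : 1 ≤ r)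
    (hsmall : kappaW a L μ0sq C₂ * P.mesh 1 < 1) {v : EuclideanSpace ℝ (Fin P.d)} (hv : v ≠ 0) (x : HiggsLattice.Site P 0) :
    ‖cutMin (zeroCharge P.d) μ0sq a 1 (zeta244 P 1 (B2.rFn R r (P.mesh 1))) (fun _ => v) x - v‖ < ‖v‖ := by
  have h := norm_cutMin_const_sub_le pkg hδ hC₂ S hPd hPL hK1 hsε hs1 hR6 hRδ hr v x
  subst hPL
  have hLr : (1 : ℝ) < P.L := by exact_mod_cast S.hL.2
  set s : ℝ := P.mesh 1 with hs_def
  have hs : 0 < s := P.mesh_pos 1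
  have hainf : 0 < a * (1 - ((P.L : ℝ) ^ 2)⁻¹) := by
    have hL2 : 1 < (P.L : ℝ) ^ 2 := by nlinarith
    have : ((P.L : ℝ) ^ 2)⁻¹ < 1 := inv_lt_one_of_one_lt₀ hL2
    exact mul_pos ha (by linarith)
  have hak : a * (1 - ((P.L : ℝ) ^ 2)⁻¹) < B1.aSeq a P.L 1 := B1.ainf_lt_aSeq ha hLr 1 le_rfl
  -- the third term: `μ₀²s²/(a₁ + μ₀²s²) ≤ μ₀²s²/a_∞ ≤ (μ₀²/a_∞)·s`
  have hfrac : μ0sq * s ^ 2 / (B1.aSeq a P.L 1 + μ0sq * s ^ 2) ≤ μ0sq / (a * (1 - ((P.L : ℝ) ^ 2)⁻¹)) * s := by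
    have hden : a * (1 - ((P.L : ℝ) ^ 2)⁻¹) ≤ B1.aSeq a P.L 1 + μ0sq * s ^ 2 := by nlinarith [sq_nonneg s]
    calc μ0sq * s ^ 2 / (B1.aSeq a P.L 1 + μ0sq * s ^ 2)
        ≤ μ0sq * s ^ 2 / (a * (1 - ((P.L : ℝ) ^ 2)⁻¹)) := div_le_div_of_nonneg_left (by positivity) hainf hden
      _ = μ0sq / (a * (1 - ((P.L : ℝ) ^ 2)⁻¹)) * (s * s) := by rw [sq]; ring
      _ ≤ μ0sq / (a * (1 - ((P.L : ℝ) ^ 2)⁻¹)) * (s * 1) := by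
          apply mul_le_mul_of_nonneg_left _ (div_nonneg hμ.le hainf.le)
          exact mul_le_mul_of_nonneg_left hs1 hs.le
      _ = μ0sq / (a * (1 - ((P.L : ℝ) ^ 2)⁻¹)) * s := by rw [mul_one]
  have hrate : C₂ * s + μ0sq * s ^ 2 / (B1.aSeq a P.L 1 + μ0sq * s ^ 2) ≤ kappaW a P.L μ0sq C₂ * s := by
    unfold kappaW
    rw [add_mul]
    linarith
  have hvpos : 0 < ‖v‖ := norm_pos_iff.mpr hv
  calc ‖cutMin (zeroCharge P.d) μ0sq a 1 (zeta244 P 1 (B2.rFn R r s)) (fun _ => v) x - v‖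
      ≤ (C₂ * s + μ0sq * s ^ 2 / (B1.aSeq a P.L 1 + μ0sq * s ^ 2)) * ‖v‖ := h
    _ ≤ kappaW a P.L μ0sq C₂ * s * ‖v‖ := mul_le_mul_of_nonneg_right hrate hvpos.le
    _ < 1 * ‖v‖ := mul_lt_mul_of_pos_right hsmall hvpos
    _ = ‖v‖ := one_mul _

variable {Q : B2.Params} {Γ : MinConsts} {m2 : ℝ}

/-- **THE FIELD OF THE WITNESS IS NOT ZERO** for `v ≠ 0`, `R ≥ max(6, 2/δ)`, `r ≥ 1` and `κ·Lε < 1` (with gen 11's Lemma-2.3 constants for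
`(Q.d, Q.L, Q.a, μ₀², ε₀)`): at the base fine point `x`, `A^{(1),ε}(x) ≠ 0` since `‖A^{(1),ε}(x) − v‖ < ‖v‖`, and `Ã^ε(⟨x, μ⟩) = A^{(1),ε}(x)_μ`.
[cite: Balaban1982Higgs2, Prop. 3.1 p.589, (3.2)–(3.3) p.583, Lemma 2.3 p.571] -/
theorem witness_field_ne_zero (hΓ : Γ.Valid) (hQa : 0 < Q.a) {δ C₁ C₂ : ℝ}
    (pkg : Lemma23Bounds Q.d Q.L Q.a Γ.μ0sq Γ.ε₀ δ C₁ C₂) (hδ : 0 < δ) (hC₂ : 0 ≤ C₂)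
    (hR : 6 ≤ Q.R) (hRδ : 2 / δ ≤ Q.R) (hr : 1 ≤ Q.r) (P : HiggsLattice.Params) (S : Shape P) (hPL : P.L = Q.L)
    (hPd : P.d = Q.d) (hK1 : 1 ≤ P.K) (hε₀ : P.mesh 1 ≤ Γ.ε₀) (hsmall : kappaW Q.a Q.L Γ.μ0sq C₂ * P.mesh 1 < 1)
    {v : EuclideanSpace ℝ (Fin P.d)} (hv : v ≠ 0) :
    (witness (m2 := m2) hΓ hR (by linarith) P S hPL hPd hK1 hε₀ v).field ≠ 0 := by
  intro h0
  have hs1 : P.mesh 1 ≤ 1 := hε₀.trans hΓ.ε₀_le_one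
  set x : HiggsLattice.Site P 0 := default
  have hlt := norm_cutMin_const_sub_lt hQa hΓ.μ0sq_pos pkg hδ hC₂ S hPd hPL hK1 hε₀ hs1 hR hRδ hr hsmall hv x
  have hne : cutMin (zeroCharge P.d) Γ.μ0sq Q.a 1 (zeta244 P 1 (B2.rFn Q.R Q.r (P.mesh 1))) (fun _ => v) x ≠ 0 := by
    intro hz
    rw [hz, zero_sub, norm_neg] at hlt
    exact lt_irrefl _ hlt
  apply hne
  ext μ
  have hb := congrFun h0 ⟨x, μ⟩
  rw [witness_field_apply] at hb
  rw [hb]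
  rfl

end NonZero

/-! ## §3 Non-vacuity packaged: every torus with a fine enough lattice; and one explicit torus -/

section Packaged

/-- `thrA(s) > 0` for `c_{A1} > 0`, `b₀ > 0`, `0 < s ≤ 1` (so non-zero admissible constant block fields exist).
[cite: Balaban1982Higgs2, (2.55) p.570] -/
theorem thrA_pos {Γ : MinConsts} (hΓ : Γ.Valid) (hcA : 0 < Γ.cA1) (hb₀ : 0 < Γ.b₀) (d : ℕ) {s : ℝ} (hs : 0 < s) (hs1 : s ≤ 1) :
    0 < Γ.thrA d s := by
  unfold MinConsts.thrA B2.pFn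
  have hu : 1 ≤ 1 + Real.log s⁻¹ := one_le_u hs hs1
  have h1 : 0 < (1 + Real.log s⁻¹) ^ Γ.p := Real.rpow_pos_of_pos (by linarith) _
  have h2 : 0 < s ^ (-(d : ℝ) / 2) := Real.rpow_pos_of_pos hs _
  have := hΓ.p_pos
  positivity

/-- **NON-VACUITY OF THE CORRECTED FAMILY AT `K = 1` WITH A NON-ZERO FIELD, ON EVERY TORUS WITH A FINE ENOUGH LATTICE.**  For `d ≥ 1`, odd
`L > 1`, `a > 0` and a valid constants record `Γ` there are `R₁ > 0` and `0 < s₁ ≤ ε₀` (through r14's Lemma-2.3 constants) such that: for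
every parameter record `Q` with `Q.d = d`, `Q.L = L`, `Q.a = a`, `Q.R ≥ R₁`, `Q.r ≥ 1`, every `m²`, every torus `P` of the sub-family with
`P.d = d`, `P.L = L`, `P.K ≥ 1` and `Lε ≤ s₁`, and every constant block-field value `v ≠ 0` obeying (2.55)₂ `‖v‖ ≤ thrA(Lε)`, there is an
instance `i : RMultiMK Q Γ m²` on `P` with ONE step, small-field region `Λ₅⁽⁰⁾ = T_ε`, `i.restrictedM`, and `i.field ≠ 0`.
[cite: Balaban1982Higgs2, Prop. 3.1 p.589, (3.3) p.583, (2.44) p.566, (2.55) p.570, Lemma 2.3 p.571] -/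
theorem exists_restrictedM_field_ne_zero (d L : ℕ) (hd : 1 ≤ d) (hL : Odd L ∧ 1 < L) {a : ℝ} (ha : 0 < a)
    (Γ : MinConsts) (hΓ : Γ.Valid) :
    ∃ R₁ s₁ : ℝ, 0 < R₁ ∧ 0 < s₁ ∧ s₁ ≤ Γ.ε₀ ∧
      ∀ (Q : B2.Params), Q.d = d → Q.L = L → Q.a = a → R₁ ≤ Q.R → 1 ≤ Q.r → ∀ (m2 : ℝ)
        (P : HiggsLattice.Params) (_S : Shape P), P.d = d → P.L = L → 1 ≤ P.K → P.mesh 1 ≤ s₁ →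
        ∀ v : EuclideanSpace ℝ (Fin P.d), ‖v‖ ≤ Γ.thrA P.d (P.mesh 1) → v ≠ 0 →
          ∃ i : RMultiMK Q Γ m2, i.P = P ∧ i.K = 1 ∧ i.T.lam 0 = Finset.univ ∧ i.restrictedM ∧ i.field ≠ 0 := by
  obtain ⟨δ, C₁, C₂, hδ, hC₁, hC₂, pkg⟩ := exists_lemma23Bounds d L hd hL ha hΓ.μ0sq_pos Γ.ε₀
  set κ : ℝ := kappaW a L Γ.μ0sq C₂ with hκ
  have hκ0 : 0 ≤ κ := kappaW_nonneg ha hL.2 hΓ.μ0sq_pos.le hC₂.le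
  refine ⟨max 6 (2 / δ), min Γ.ε₀ (1 / (2 * (κ + 1))), lt_max_of_lt_left (by norm_num),
    lt_min hΓ.ε₀_pos (by positivity), min_le_left _ _, ?_⟩
  intro Q hQd hQL hQa hR hr m2 P S hPd hPL hK1 hs v hv hv0
  subst hQd hQL hQa
  have hR6 : 6 ≤ Q.R := le_trans (le_max_left _ _) hR
  have hRδ : 2 / δ ≤ Q.R := le_trans (le_max_right _ _) hR
  have hε₀ : P.mesh 1 ≤ Γ.ε₀ := hs.trans (min_le_left _ _)
  have hsmall : kappaW Q.a Q.L Γ.μ0sq C₂ * P.mesh 1 < 1 := by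
    rw [← hκ]
    have h1 : P.mesh 1 ≤ 1 / (2 * (κ + 1)) := hs.trans (min_le_right _ _)
    have h2 : κ * P.mesh 1 ≤ κ * (1 / (2 * (κ + 1))) := mul_le_mul_of_nonneg_left h1 hκ0
    have h3 : κ * (1 / (2 * (κ + 1))) < 1 := by
      rw [mul_one_div, div_lt_one (by positivity)]
      linarith
    linarith
  refine ⟨witness hΓ hR6 (by linarith) P S hPL hPd hK1 hε₀ v, rfl, rfl, witness_lam_zero _ _ _ _ _ _ _ _ _ _,
    witness_restrictedM hΓ hR6 (by linarith) P S hPL hPd hK1 hε₀ v hv, ?_⟩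
  exact witness_field_ne_zero hΓ ha pkg hδ hC₂.le hR6 hRδ hr P S hPL hPd hK1 hε₀ hsmall hv0

/-- A torus of the sub-family with ONE renormalization step and prescribed coarse mesh `Lε = s`: `d`, `L`, `K = 1`, `M = 1`,
`L′_μ = Lᵐ`, `ε = s/L`. [cite: Balaban1982Higgs1, (1.2) p.604, (1.19) p.607] -/
def witnessTorus (d L m : ℕ) (hd : 1 ≤ d) (hL : 1 < L) {s : ℝ} (hs : 0 < s) : HiggsLattice.Params where
  d := d
  ε := s / L
  K := 1
  L := L
  M := 1
  Lp := fun _ => L ^ m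
  hd := hd
  hε := div_pos hs (by exact_mod_cast (zero_lt_one.trans hL))
  hL := zero_lt_one.trans hL
  hM := one_pos
  hLp := fun _ => pow_pos (zero_lt_one.trans hL) m

/-- It belongs to the torus sub-family `M·L′_μ = Lᵐ`, `L` odd. [cite: Balaban1982Higgs1, (1.2) p.604] -/
def witnessShape (d L m : ℕ) (hd : 1 ≤ d) (hL : Odd L ∧ 1 < L) {s : ℝ} (hs : 0 < s) : Shape (witnessTorus d L m hd hL.2 hs) :=
  ⟨m, hL, fun _ => by show 1 * L ^ m = L ^ m; rw [one_mul]⟩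

/-- Its coarse mesh is `Lε = s`. [cite: Balaban1982Higgs1, (1.19) p.607] -/
theorem witnessTorus_mesh_one (d L m : ℕ) (hd : 1 ≤ d) (hL : 1 < L) {s : ℝ} (hs : 0 < s) :
    (witnessTorus d L m hd hL hs).mesh 1 = s := by
  show (L : ℝ) ^ 1 * (s / L) = s
  have : (L : ℝ) ≠ 0 := by exact_mod_cast (zero_lt_one.trans hL).ne'
  field_simp

/-- **HYPOTHESIS-FREE COROLLARY**: for `d ≥ 1`, odd `L > 1`, `a > 0`, a valid `Γ` with `c_{A1} > 0`, `b₀ > 0` (the O(1)'s of (2.55)₂ and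
`p(ε)` are positive in print) and every size exponent `m`, there is `R₁ > 0` such that for every `Q` (`Q.d = d`, `Q.L = L`, `Q.a = a`,
`Q.R ≥ R₁`, `Q.r ≥ 1`) and every `m²` the corrected family has an instance with ONE step on a torus `M·L′_μ = Lᵐ`, small-field region the
whole torus, `restrictedM`, and field `Ã^ε ≠ 0`. [cite: Balaban1982Higgs2, Prop. 3.1 p.589, (3.3) p.583, (2.44) p.566, (2.55) p.570] -/
theorem exists_restrictedM_field_ne_zero' (d L m : ℕ) (hd : 1 ≤ d) (hL : Odd L ∧ 1 < L) {a : ℝ} (ha : 0 < a)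
    (Γ : MinConsts) (hΓ : Γ.Valid) (hcA : 0 < Γ.cA1) (hb₀ : 0 < Γ.b₀) :
    ∃ R₁ : ℝ, 0 < R₁ ∧ ∀ (Q : B2.Params), Q.d = d → Q.L = L → Q.a = a → R₁ ≤ Q.R → 1 ≤ Q.r → ∀ (m2 : ℝ),
      ∃ i : RMultiMK Q Γ m2, i.K = 1 ∧ i.P.K = 1 ∧ i.P.M = 1 ∧ (∀ μ, i.P.Lp μ = L ^ m) ∧
        i.T.lam 0 = Finset.univ ∧ i.restrictedM ∧ i.field ≠ 0 := by
  obtain ⟨R₁, s₁, hR₁, hs₁, hs₁ε, h⟩ := exists_restrictedM_field_ne_zero d L hd hL ha Γ hΓ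
  refine ⟨R₁, hR₁, fun Q hQd hQL hQa hR hr m2 => ?_⟩
  set P : HiggsLattice.Params := witnessTorus d L m hd hL.2 hs₁ with hP
  have hmesh : P.mesh 1 = s₁ := witnessTorus_mesh_one d L m hd hL.2 hs₁
  have hs1 : s₁ ≤ 1 := hs₁ε.trans hΓ.ε₀_le_one
  have hthr : 0 < Γ.thrA P.d (P.mesh 1) := by rw [hmesh]; exact thrA_pos hΓ hcA hb₀ _ hs₁ hs1
  set v : EuclideanSpace ℝ (Fin P.d) := EuclideanSpace.single (⟨0, hd⟩ : Fin P.d) (Γ.thrA P.d (P.mesh 1)) with hv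
  have hvn : ‖v‖ = Γ.thrA P.d (P.mesh 1) := by
    rw [hv]
    exact (PiLp.norm_single 2 (fun _ : Fin P.d => ℝ) _ _).trans (by rw [Real.norm_eq_abs, abs_of_pos hthr])
  have hv0 : v ≠ 0 := by
    intro h0
    rw [h0, norm_zero] at hvn
    exact hthr.ne' hvn.symm
  obtain ⟨i, hiP, hiK, hlam, hres, hfield⟩ :=
    h Q hQd hQL hQa hR hr m2 P (witnessShape d L m hd hL hs₁) rfl rfl le_rfl hmesh.le v hvn.le hv0
  have hLp : i.P.Lp = fun _ => L ^ m := by rw [hiP]; rfl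
  exact ⟨i, hiK, by rw [hiP]; rfl, by rw [hiP]; rfl, fun μ => congrFun hLp μ, hlam, hres, hfield⟩

end Packaged

end Literature.MathematicalPhysics.QuantumFieldTheory.Balaban1983to89.B2Prop31MinimizerWitness

end
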